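import Mathlib
import Summits.NavierStokesRegularity.NavierStokesRegularity.Theorems.EulerZoomLiouvillePowerGaugeEulerLiouvillePowerClockFiniteEnergy
import Summits.NavierStokesRegularity.NavierStokesRegularity.Theorems.EulerZoomLiouvillePowerGaugeEulerLiouvillePastSymmetric
import Summits.NavierStokesRegularity.NavierStokesRegularity.Theorems.EulerZoomLiouvillePowerGaugeEulerLiouvilleFluxWindow
import HarnessLib

/-!
# DISCRETE BREATHERS are trivial: expanding ones by the `A`-gauge, contracting ones of locally bounded energy by energy vanishing,
# and ALL of them at the endpoint `ρ = ½` (crux `EulerZoomLiouville.PowerGaugeEulerLiouville` = stmt-NavierStokesRegularity-19832;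
# line `logtime-breathers` of ns-idea-11 — the DSS-ification of its breather chapter; PROFILE-FREE, WEAK class)

Route `EulerZoomLiouville` (NavierStokesRegularity); width seat ns-ezl-w4 g2.  A LOG-TIME BREATHER `u(τ, y) = e^{cτ} V(e^{−cτ} y)` is invariant under the
whole one-parameter group «translate time by `P`, dilate space and amplitude by `e^{cP}`».  A member is a DISCRETE BREATHER on the past sub-slab
`(−∞, T₁)` if it is invariant under ONE element of this group: for some period `P₀ > 0` and ratio `Λ > 0`, `Λ ≠ 1`,

> `u(τ, y) = Λ · u(τ − P₀, y/Λ)` for all `τ < T₁` and all `y`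

(the exact breather has `Λ = e^{cP₀}`; `Λ = 1` is TIME-PERIODICITY, already dead in the weak class — `IsSymmetricWeak`).  No profile, no regularity, no
shape-preservation is assumed: between the times `τ − P₀` and `τ` the member is arbitrary.  Iterating, `u(τ − nP₀, ·) = Λ^{−n} u(τ, Λ^{n}·)`, so the
ball energies of the slices along the orbit are rescalings of one another (`∫_{B_a} |u(τ − nP₀)|² = Λ^{−5n} ∫_{B_{Λ^{n} a}} |u(τ)|²`), and gauge
arithmetic ALONG THE ORBIT kills:

* `Λ < 1` (EXPANDING into the past, `c < 0`): the `A`-gauge at the time `τ − nP₀` on the ball of radius `a_n = Λ^{−n}R + (nP₀ − τ + 1)` gives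
  `∫_{B_R}|u(τ)|² ≤ c Λ^{5n} a_n^{1−2ρ} ≤ c (Λ^{4n} R + Λ^{5n}(nP₀ − τ + 1)) → 0`: every slice before `T₁` is zero, and the tree's
  `PastSymmetric.ae_eq_zero_of_gauge_of_pastSlicesZero` concludes (any `ρ ≥ 0`; ⊇ T2a `PastShape.…pastExpandingBreather`);
* `Λ > 1` (CONTRACTING, `c > 0`) with LOCALLY BOUNDED SLICE ENERGY `∫|u(τ)|² ≤ E₀` for `τ` in some interval `(α, β)`, `β ≤ T₁`: the energies along the
  orbit are `Λ^{−5n} ∫|u(τ)|² → 0` on the intervals `(α − nP₀, β − nP₀) → −∞`, so the past is energy-quiescent and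
  `ae_eq_zero_of_gauge_of_energyVanishing_allRho` concludes (any `ρ ≥ 0`; ⊇ `LogtimeBreather.…finiteEnergyBreather`);
* ENDPOINT `ρ = ½`: the energy bound is automatic (`lintegral_enorm_sq_le_of_gauge_half`), so EVERY discrete breather (`Λ ≠ 1`) is trivial.

* `DiscreteBreather.iterate` — `u(τ, y) = Λⁿ u(τ − nP₀, Λ^{−n} y)`;
* `DiscreteBreather.lintegral_ball_slice_eq_zero_of_expanding`, `DiscreteBreather.ae_eq_zero_of_gauge_of_expanding` (`Λ < 1`);
* `DiscreteBreather.ae_eq_zero_of_gauge_of_contracting_of_energyBound` (`Λ > 1`, locally bounded energy);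
* `DiscreteBreather.ae_eq_zero_of_gauge_half` (`ρ = ½`, any `Λ ≠ 1`).

These members need not be shape-preserving: the stratum lies in the line's residue T5 (`stub_shapelessRest`) and in the weak part of
`stub_nonSelfSimilarRest`, next to the time-periodic and DSS strata.

WHAT THIS IS NOT: not NS, not E — strata of the crux CLASS 19832 on the MODEL lattice, `--supports` stmt-19832; contracting discrete breathers of
locally unbounded (infinite) energy stay OPEN for `ρ < ½`. [folklore; line card `Cruxes/PowerGaugeEulerLiouville/Lines/logtime-breathers.md` T2a/T3/T5]
-/

noncomputable section

-- flat `Theorems/<Route><Decl>…` files of one crux share the namespace of the crux (tree convention: `Summit.<S>.<S>.…`)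
set_option linter.dupNamespace false

open MeasureTheory Set Filter Topology Metric Function TopologicalSpace Module
open scoped ENNReal NNReal

namespace Summit.NavierStokesRegularity.NavierStokesRegularity.Theorems.PowerGaugeEulerLiouville

open Literature.Analysis Literature.Analysis.FunctionSpaces Literature.Analysis.FluidPDE

namespace DiscreteBreather

variable {u : ℝ → EuclideanSpace ℝ (Fin 3) → EuclideanSpace ℝ (Fin 3)} {p : ℝ → EuclideanSpace ℝ (Fin 3) → ℝ}
  {H : ℝ → EuclideanSpace ℝ (Fin 3) → EuclideanSpace ℝ (Fin 3) →L[ℝ] EuclideanSpace ℝ (Fin 3)} {c : ℝ≥0}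
  {T₁ P₀ Λ : ℝ}

/-! ### The orbit of the group element -/

/-- **Iteration of the discrete breather symmetry**: `u(τ, y) = Λⁿ u(τ − nP₀, Λ^{−n} y)` for `τ < T₁` (`P₀ ≥ 0`; with Mathlib's total `x⁻¹` the
identity is formal, no `Λ ≠ 0` needed). [folklore] -/
theorem iterate (hP₀ : 0 ≤ P₀)
    (h : ∀ τ : ℝ, τ < T₁ → ∀ y, u τ y = Λ • u (τ - P₀) (Λ⁻¹ • y)) :
    ∀ n : ℕ, ∀ τ : ℝ, τ < T₁ → ∀ y, u τ y = Λ ^ n • u (τ - n * P₀) ((Λ ^ n)⁻¹ • y) := by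
  intro n
  induction n with
  | zero => intro τ hτ y; simp
  | succ n ih =>
    intro τ hτ y
    have hτn : τ - n * P₀ < T₁ := by nlinarith
    rw [ih τ hτ y, h (τ - n * P₀) hτn ((Λ ^ n)⁻¹ • y), smul_smul, smul_smul]
    have e1 : Λ ^ n * Λ = Λ ^ (n + 1) := by rw [pow_succ]
    have e2 : τ - n * P₀ - P₀ = τ - ((n + 1 : ℕ) : ℝ) * P₀ := by push_cast; ring
    have e3 : Λ⁻¹ * (Λ ^ n)⁻¹ = (Λ ^ (n + 1))⁻¹ := by rw [pow_succ, mul_inv, mul_comm]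
    rw [e1, e2, e3]

/-- The earlier slices along the orbit in terms of the later one: `u(τ − nP₀, x) = Λ^{−n} u(τ, Λⁿ x)` (`τ < T₁`). [folklore] -/
theorem slice_sub_eq (hP₀ : 0 ≤ P₀) (hΛ : Λ ≠ 0)
    (h : ∀ τ : ℝ, τ < T₁ → ∀ y, u τ y = Λ • u (τ - P₀) (Λ⁻¹ • y))
    (n : ℕ) {τ : ℝ} (hτ : τ < T₁) (x : EuclideanSpace ℝ (Fin 3)) :
    u (τ - n * P₀) x = (Λ ^ n)⁻¹ • u τ ((Λ ^ n)⁻¹⁻¹ • x) := by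
  have hΛn : Λ ^ n ≠ 0 := pow_ne_zero n hΛ
  have hit := iterate hP₀ h n τ hτ (Λ ^ n • x)
  rw [smul_smul, inv_mul_cancel₀ hΛn, one_smul] at hit
  rw [inv_inv, hit, smul_smul, inv_mul_cancel₀ hΛn, one_smul]

/-! ### Expanding discrete breathers (`Λ < 1`): every slice is zero -/

/-- **`Λ < 1` + `A`-gauge ⇒ the slices before `T₁` have zero energy on every ball** (`ρ ≥ 0`, `T₁ ≤ 0`, `P₀ > 0`): at the time `τ − nP₀` and radius
`a_n = Λ^{−n} R + (nP₀ − τ + 1)` (admissible: `a_n² ≥ a_n > nP₀ − τ`) the gauge reads `Λ^{−5n}∫_{B_R}|u(τ)|² ≤ ∫_{B_{a_n}}|u(τ − nP₀)|² ≤ c a_n^{1−2ρ} ≤ c a_n`,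
so `∫_{B_R}|u(τ)|² ≤ c(Λ^{4n}R + Λ^{5n}(nP₀ − τ + 1)) → 0`. [folklore] -/
theorem lintegral_ball_slice_eq_zero_of_expanding {ρ : ℝ} (hρ : 0 ≤ ρ)
    (hA : ∀ a : ℝ, 0 < a → ENNReal.ofReal (a ^ (2 * ρ)) *
      cknA a (0 : ℝ × EuclideanSpace ℝ (Fin 3)) u ≤ (c : ℝ≥0∞))
    (hT₁ : T₁ ≤ 0) (hP₀ : 0 < P₀) (hΛ0 : 0 < Λ) (hΛ1 : Λ < 1)
    (h : ∀ τ : ℝ, τ < T₁ → ∀ y, u τ y = Λ • u (τ - P₀) (Λ⁻¹ • y))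
    {τ : ℝ} (hτ : τ < T₁) {R : ℝ} (hR : 0 < R) :
    ∫⁻ y in ball (0 : EuclideanSpace ℝ (Fin 3)) R, ‖u τ y‖ₑ ^ 2 = 0 := by
  have hS := hasScaledLocalEnergyBound_of_gaugeA hA
  have hτ0 : τ < 0 := lt_of_lt_of_le hτ hT₁
  set J : ℝ≥0∞ := ∫⁻ y in ball (0 : EuclideanSpace ℝ (Fin 3)) R, ‖u τ y‖ₑ ^ 2 with hJ
  -- ### the bound along the orbit
  have hbound : ∀ n : ℕ, J ≤ ENNReal.ofReal ((c : ℝ) * (Λ ^ (4 * n) * R + Λ ^ (5 * n) * (n * P₀ - τ + 1))) := by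
    intro n
    have hΛn : 0 < Λ ^ n := pow_pos hΛ0 n
    set t : ℝ := τ - n * P₀ with ht
    set a : ℝ := (Λ ^ n)⁻¹ * R + (n * P₀ - τ + 1) with ha
    have hnP : 0 ≤ (n : ℝ) * P₀ := by positivity
    have ha1 : 1 ≤ a := by
      have : 0 ≤ (Λ ^ n)⁻¹ * R := by positivity
      rw [ha]; linarith
    have ha0 : 0 < a := by linarith
    have haR : (Λ ^ n)⁻¹ * R ≤ a := by rw [ha]; linarith
    -- admissibility of the slice `t ∈ (−a², 0)`
    have hat : n * P₀ - τ + 1 ≤ a := by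
      have : 0 ≤ (Λ ^ n)⁻¹ * R := by positivity
      rw [ha]; linarith
    have hmem : t ∈ Ioo (-(a ^ 2)) 0 := by
      refine ⟨?_, by rw [ht]; linarith⟩
      have : a ≤ a ^ 2 := by nlinarith
      rw [ht]; linarith
    -- the slice at time `t` on `B_a` is a rescaling of `u τ`
    have hfun : (fun x => ‖u t x‖ₑ ^ 2) = fun x => ‖(Λ ^ n)⁻¹ • u τ (((Λ ^ n)⁻¹)⁻¹ • x)‖ₑ ^ 2 := by
      funext x; rw [ht, slice_sub_eq hP₀.le hΛ0.ne' h n hτ x]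
    have hgauge := hS a ha0 t hmem
    rw [hfun, PastShape.lintegral_ball_shape (inv_pos.2 hΛn) (u τ) a, inv_inv] at hgauge
    -- `hgauge : ofReal ((Λ^n)⁻² (Λ^n)⁻³) * ∫_{B_{Λ^n a}} |u τ|² ≤ ofReal (c a^{1−2ρ})`, and `B_R ⊆ B_{Λ^n a}`
    have hRa : R ≤ Λ ^ n * a := by
      have := mul_le_mul_of_nonneg_left haR hΛn.le
      rwa [← mul_assoc, mul_inv_cancel₀ hΛn.ne', one_mul] at this
    have hJle : J ≤ ∫⁻ y in ball (0 : EuclideanSpace ℝ (Fin 3)) (Λ ^ n * a), ‖u τ y‖ₑ ^ 2 :=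
      lintegral_mono_set (ball_subset_ball hRa)
    set K : ℝ := ((Λ ^ n)⁻¹) ^ 2 * ((Λ ^ n)⁻¹) ^ 3 with hK
    have hK0 : 0 < K := by positivity
    have hKinv : K⁻¹ = Λ ^ (5 * n) := by
      rw [hK, ← pow_add, inv_pow, inv_inv, ← pow_mul]
      congr 1
      ring
    have hunit : ENNReal.ofReal K⁻¹ * ENNReal.ofReal K = 1 := by
      rw [← ENNReal.ofReal_mul (inv_nonneg.2 hK0.le), inv_mul_cancel₀ hK0.ne', ENNReal.ofReal_one]
    -- `a^{1−2ρ} ≤ a`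
    have hapow : a ^ (1 - 2 * ρ) ≤ a := by
      have := Real.rpow_le_rpow_of_exponent_le ha1 (show 1 - 2 * ρ ≤ 1 by linarith)
      rwa [Real.rpow_one] at this
    calc J ≤ ∫⁻ y in ball (0 : EuclideanSpace ℝ (Fin 3)) (Λ ^ n * a), ‖u τ y‖ₑ ^ 2 := hJle
      _ = ENNReal.ofReal K⁻¹ * (ENNReal.ofReal K *
            ∫⁻ y in ball (0 : EuclideanSpace ℝ (Fin 3)) (Λ ^ n * a), ‖u τ y‖ₑ ^ 2) := by
          rw [← mul_assoc, hunit, one_mul]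
      _ ≤ ENNReal.ofReal K⁻¹ * ENNReal.ofReal (c * a ^ (1 - 2 * ρ)) := mul_le_mul_right hgauge _
      _ ≤ ENNReal.ofReal K⁻¹ * ENNReal.ofReal (c * a) := by
          gcongr
      _ = ENNReal.ofReal ((c : ℝ) * (Λ ^ (4 * n) * R + Λ ^ (5 * n) * (n * P₀ - τ + 1))) := by
          rw [← ENNReal.ofReal_mul (inv_nonneg.2 hK0.le), hKinv, ha]
          congr 1
          have : Λ ^ (5 * n) * (Λ ^ n)⁻¹ = Λ ^ (4 * n) := by
            rw [show 5 * n = 4 * n + n by ring, pow_add, mul_assoc, mul_inv_cancel₀ hΛn.ne', mul_one]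
          calc Λ ^ (5 * n) * (c * ((Λ ^ n)⁻¹ * R + (n * P₀ - τ + 1)))
              = c * (Λ ^ (5 * n) * (Λ ^ n)⁻¹ * R + Λ ^ (5 * n) * (n * P₀ - τ + 1)) := by ring
            _ = c * (Λ ^ (4 * n) * R + Λ ^ (5 * n) * (n * P₀ - τ + 1)) := by rw [this]
  -- ### `n → ∞`
  have hlim : Tendsto (fun n : ℕ => (c : ℝ) * (Λ ^ (4 * n) * R + Λ ^ (5 * n) * (n * P₀ - τ + 1))) atTop (𝓝 0) := by
    have h4 : Tendsto (fun n : ℕ => (Λ ^ 4) ^ n) atTop (𝓝 0) :=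
      tendsto_pow_atTop_nhds_zero_of_lt_one (by positivity) (by nlinarith [pow_lt_one₀ hΛ0.le hΛ1 four_ne_zero])
    have h5 : Tendsto (fun n : ℕ => (Λ ^ 5) ^ n) atTop (𝓝 0) :=
      tendsto_pow_atTop_nhds_zero_of_lt_one (by positivity) (by nlinarith [pow_lt_one₀ hΛ0.le hΛ1 (by norm_num : (5 : ℕ) ≠ 0)])
    have h5n : Tendsto (fun n : ℕ => (n : ℝ) * (Λ ^ 5) ^ n) atTop (𝓝 0) :=
      tendsto_self_mul_const_pow_of_lt_one (by positivity) (pow_lt_one₀ hΛ0.le hΛ1 (by norm_num))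
    have hsum : Tendsto (fun n : ℕ => (c : ℝ) * ((Λ ^ 4) ^ n * R + ((n : ℝ) * (Λ ^ 5) ^ n * P₀ + (Λ ^ 5) ^ n * (-τ + 1))))
        atTop (𝓝 ((c : ℝ) * (0 * R + (0 * P₀ + 0 * (-τ + 1))))) :=
      ((h4.mul_const R).add ((h5n.mul_const P₀).add (h5.mul_const _))).const_mul _
    simp only [zero_mul, add_zero, mul_zero] at hsum
    refine hsum.congr fun n => ?_
    rw [← pow_mul, ← pow_mul, mul_comm 4 n, mul_comm 5 n]
    ring_nf
  have hlim' : Tendsto (fun n : ℕ => ENNReal.ofReal ((c : ℝ) * (Λ ^ (4 * n) * R + Λ ^ (5 * n) * (n * P₀ - τ + 1))))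
      atTop (𝓝 0) := by
    have := ENNReal.tendsto_ofReal hlim
    rwa [ENNReal.ofReal_zero] at this
  exact le_antisymm (ge_of_tendsto hlim' (Eventually.of_forall hbound)) bot_le

/-- **EXPANDING DISCRETE BREATHERS ARE TRIVIAL** (crux hypotheses verbatim — suitable weak Euler pair on the slab, weak gradient, the three power gauges —,
any `ρ ≥ 0`; no profile, no regularity): if `u(τ, y) = Λ u(τ − P₀, y/Λ)` for all `τ < T₁` (`T₁ ≤ 0`) with `P₀ > 0`, `0 < Λ < 1`, then `u = 0` a.e. on
`(−∞,0) × ℝ³`: every slice before `T₁` vanishes on every ball (`lintegral_ball_slice_eq_zero_of_expanding`), hence identically (countable subadditivity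
over balls), and `PastSymmetric.ae_eq_zero_of_gauge_of_pastSlicesZero` concludes.  ⊇ the exact expanding breathers (`Λ = e^{cP₀}`, `c < 0`;
`PastShape.ae_eq_zero_of_gauge_of_pastExpandingBreather`). [folklore] -/
theorem ae_eq_zero_of_gauge_of_expanding {ρ : ℝ} (hρ : 0 ≤ ρ)
    (hsw : IsSuitableWeakSolutionOn (slab (EuclideanSpace ℝ (Fin 3)) (Iio 0) isOpen_Iio) 0 0 u p)
    (hH : HasWeakSpatialGradientOn (slab (EuclideanSpace ℝ (Fin 3)) (Iio 0) isOpen_Iio) u H)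
    (hgauge : ∀ a : ℝ, 0 < a →
      ENNReal.ofReal (a ^ (2 * ρ)) * cknA a (0 : ℝ × EuclideanSpace ℝ (Fin 3)) u +
          ENNReal.ofReal (a ^ ρ) * cknE a (0 : ℝ × EuclideanSpace ℝ (Fin 3)) H +
        ENNReal.ofReal (a ^ (2 * ρ)) * cknD a (0 : ℝ × EuclideanSpace ℝ (Fin 3)) p ≤ (c : ℝ≥0∞))
    (hT₁ : T₁ ≤ 0) (hP₀ : 0 < P₀) (hΛ0 : 0 < Λ) (hΛ1 : Λ < 1)
    (h : ∀ τ : ℝ, τ < T₁ → ∀ y, u τ y = Λ • u (τ - P₀) (Λ⁻¹ • y)) :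
    uncurry u =ᵐ[volume.restrict (Iio (0 : ℝ) ×ˢ (univ : Set (EuclideanSpace ℝ (Fin 3))))] 0 := by
  have hA : ∀ a : ℝ, 0 < a → ENNReal.ofReal (a ^ (2 * ρ)) *
      cknA a (0 : ℝ × EuclideanSpace ℝ (Fin 3)) u ≤ (c : ℝ≥0∞) :=
    fun a ha => le_trans (le_trans le_self_add le_self_add) (hgauge a ha)
  -- every slice before `T₁` has zero energy
  have hslice0 : ∀ s : ℝ, s < T₁ → ∫⁻ x, ‖u s x‖ₑ ^ 2 = 0 := by
    intro s hs
    have hballs : ∀ n : ℕ, ∫⁻ x in ball (0 : EuclideanSpace ℝ (Fin 3)) ((n : ℝ) + 1), ‖u s x‖ₑ ^ 2 = 0 :=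
      fun n => lintegral_ball_slice_eq_zero_of_expanding hρ hA hT₁ hP₀ hΛ0 hΛ1 h hs (by positivity)
    have hunion : (⋃ n : ℕ, ball (0 : EuclideanSpace ℝ (Fin 3)) ((n : ℝ) + 1)) = univ := by
      refine eq_univ_of_forall fun y => mem_iUnion.2 ?_
      obtain ⟨n, hn⟩ := exists_nat_gt ‖y‖
      exact ⟨n, by rw [mem_ball, dist_zero_right]; linarith⟩
    refine le_antisymm ?_ zero_le
    calc ∫⁻ x, ‖u s x‖ₑ ^ 2
        = ∫⁻ x in (⋃ n : ℕ, ball (0 : EuclideanSpace ℝ (Fin 3)) ((n : ℝ) + 1)), ‖u s x‖ₑ ^ 2 := by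
          rw [hunion, Measure.restrict_univ]
      _ ≤ ∑' n : ℕ, ∫⁻ x in ball (0 : EuclideanSpace ℝ (Fin 3)) ((n : ℝ) + 1), ‖u s x‖ₑ ^ 2 :=
          lintegral_iUnion_le _ _
      _ = 0 := by simp [hballs]
  exact PastSymmetric.ae_eq_zero_of_gauge_of_pastSlicesZero hρ hsw hH hgauge (T₁ := T₁)
    ((ae_restrict_mem measurableSet_Iio).mono fun τ hτ => hslice0 τ hτ)

/-! ### Contracting discrete breathers (`Λ > 1`) of locally bounded energy -/

/-- **CONTRACTING DISCRETE BREATHERS OF LOCALLY BOUNDED ENERGY ARE TRIVIAL** (crux hypotheses verbatim, any `ρ ≥ 0`; no profile, no regularity): if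
`u(τ, y) = Λ u(τ − P₀, y/Λ)` for all `τ < T₁` with `P₀ > 0`, `Λ > 1`, and the slice energy is bounded, `∫_{ℝ³}|u(τ)|² ≤ E₀`, for `τ` in some interval
`(α, β)` with `α < β ≤ T₁`, then `u = 0` a.e.: along the orbit `∫|u(τ − nP₀)|² = Λ^{−5n}∫|u(τ)|² ≤ Λ^{−5n} E₀ → 0` on the intervals
`(α − nP₀, β − nP₀) → −∞`, so `ae_eq_zero_of_gauge_of_energyVanishing_allRho` concludes.  ⊇ the exact contracting breathers with `V ∈ L²`
(`LogtimeBreather.ae_eq_zero_of_gauge_of_finiteEnergyBreather`). [folklore] -/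
theorem ae_eq_zero_of_gauge_of_contracting_of_energyBound {ρ : ℝ} (hρ : 0 ≤ ρ)
    (hsw : IsSuitableWeakSolutionOn (slab (EuclideanSpace ℝ (Fin 3)) (Iio 0) isOpen_Iio) 0 0 u p)
    (hH : HasWeakSpatialGradientOn (slab (EuclideanSpace ℝ (Fin 3)) (Iio 0) isOpen_Iio) u H)
    (hgauge : ∀ a : ℝ, 0 < a →
      ENNReal.ofReal (a ^ (2 * ρ)) * cknA a (0 : ℝ × EuclideanSpace ℝ (Fin 3)) u +
          ENNReal.ofReal (a ^ ρ) * cknE a (0 : ℝ × EuclideanSpace ℝ (Fin 3)) H +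
        ENNReal.ofReal (a ^ (2 * ρ)) * cknD a (0 : ℝ × EuclideanSpace ℝ (Fin 3)) p ≤ (c : ℝ≥0∞))
    (hP₀ : 0 < P₀) (hΛ : 1 < Λ)
    (h : ∀ τ : ℝ, τ < T₁ → ∀ y, u τ y = Λ • u (τ - P₀) (Λ⁻¹ • y))
    {α β E₀ : ℝ} (hαβ : α < β) (hβ : β ≤ T₁)
    (hE : ∀ τ : ℝ, τ ∈ Ioo α β → ∫⁻ y, ‖u τ y‖ₑ ^ 2 ≤ ENNReal.ofReal E₀) :
    uncurry u =ᵐ[volume.restrict (Iio (0 : ℝ) ×ˢ (univ : Set (EuclideanSpace ℝ (Fin 3))))] 0 := by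
  have hΛ0 : 0 < Λ := by linarith
  -- energies along the orbit
  have horbit : ∀ n : ℕ, ∀ τ : ℝ, τ < T₁ →
      ∫⁻ x, ‖u (τ - n * P₀) x‖ₑ ^ 2 = ENNReal.ofReal ((Λ ^ (5 * n))⁻¹) * ∫⁻ y, ‖u τ y‖ₑ ^ 2 := by
    intro n τ hτ
    have hΛn : 0 < Λ ^ n := pow_pos hΛ0 n
    have hfun : (fun x => ‖u (τ - n * P₀) x‖ₑ ^ 2) = fun x => ‖(Λ ^ n)⁻¹ • u τ (((Λ ^ n)⁻¹)⁻¹ • x)‖ₑ ^ 2 := by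
      funext x; rw [slice_sub_eq hP₀.le hΛ0.ne' h n hτ x]
    rw [hfun, PowerClock.lintegral_enorm_sq_shape_univ _ (inv_pos.2 hΛn) (u τ)]
    congr 2
    rw [← pow_add, inv_pow, ← pow_mul]
    congr 2
    ring
  refine ae_eq_zero_of_gauge_of_energyVanishing_allRho hρ hsw hH hgauge fun ε hε N => ?_
  -- choose `n` with `Λ^{−5n} E₀ < ε` and `β − nP₀ < −N`
  have h5 : Tendsto (fun n : ℕ => (Λ ^ (5 * n))⁻¹ * E₀) atTop (𝓝 (0 * E₀)) := by
    refine Tendsto.mul_const _ ?_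
    have h1 : Tendsto (fun n : ℕ => (Λ⁻¹ ^ 5) ^ n) atTop (𝓝 0) :=
      tendsto_pow_atTop_nhds_zero_of_lt_one (by positivity)
        (pow_lt_one₀ (inv_nonneg.2 hΛ0.le) (inv_lt_one_of_one_lt₀ hΛ) (by norm_num))
    refine h1.congr fun n => ?_
    rw [← pow_mul, inv_pow]
  rw [zero_mul] at h5
  have hP : Tendsto (fun n : ℕ => β - n * P₀) atTop atBot := by
    have h1 : Tendsto (fun n : ℕ => (n : ℝ) * P₀) atTop atTop :=
      tendsto_natCast_atTop_atTop.atTop_mul_const hP₀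
    exact tendsto_atBot_add_const_left _ β (tendsto_neg_atTop_atBot.comp h1) |>.congr fun n => by
      simp only [Function.comp_apply]; ring
  obtain ⟨n, hn1, hn2⟩ := ((h5.eventually (Iio_mem_nhds hε)).and (hP.eventually (eventually_lt_atBot (-N)))).exists
  -- the interval `(α − nP₀, β − nP₀)` consists of `ε`-quiet times before `−N`
  have hsub : Ioo (α - n * P₀) (β - n * P₀) ⊆ {s : ℝ | s < -N ∧ ∫⁻ x, ‖u s x‖ₑ ^ 2 ≤ ENNReal.ofReal ε} := by
    intro s hs
    obtain ⟨hs1, hs2⟩ := hs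
    refine ⟨by linarith, ?_⟩
    have hτ : s + n * P₀ ∈ Ioo α β := ⟨by linarith, by linarith⟩
    have hτT : s + n * P₀ < T₁ := lt_of_lt_of_le hτ.2 hβ
    have hs' : s = s + n * P₀ - n * P₀ := by ring
    rw [hs', horbit n (s + n * P₀) hτT]
    calc ENNReal.ofReal ((Λ ^ (5 * n))⁻¹) * ∫⁻ y, ‖u (s + n * P₀) y‖ₑ ^ 2
        ≤ ENNReal.ofReal ((Λ ^ (5 * n))⁻¹) * ENNReal.ofReal E₀ := by gcongr; exact hE _ hτ
      _ = ENNReal.ofReal ((Λ ^ (5 * n))⁻¹ * E₀) := (ENNReal.ofReal_mul (by positivity)).symm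
      _ ≤ ENNReal.ofReal ε := ENNReal.ofReal_le_ofReal hn1.le
  have hvol : volume (Ioo (α - n * P₀) (β - n * P₀)) ≠ 0 := by
    rw [Real.volume_Ioo]; exact (ENNReal.ofReal_pos.2 (by linarith)).ne'
  exact fun h0 => hvol (measure_mono_null hsub h0)

/-! ### The endpoint `ρ = ½`: every discrete breather is trivial -/

/-- **ENDPOINT `ρ = ½`: EVERY DISCRETE BREATHER IS TRIVIAL** (crux hypotheses verbatim at `ρ = ½`; weak class, no profile, no regularity):
`u(τ, y) = Λ u(τ − P₀, y/Λ)` for `τ < T₁ ≤ 0` with `P₀ > 0`, `Λ > 0`, `Λ ≠ 1` ⇒ `u = 0` a.e.  (`Λ < 1`: `ae_eq_zero_of_gauge_of_expanding`; `Λ > 1`: every slice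
has energy `≤ c` by `lintegral_enorm_sq_le_of_gauge_half`, and `ae_eq_zero_of_gauge_of_contracting_of_energyBound` on `(T₁ − 2, T₁ − 1)`.)  `Λ = 1` (time
periodicity) is the tree's `TimePeriodic` stratum. [folklore] -/
theorem ae_eq_zero_of_gauge_half
    (hsw : IsSuitableWeakSolutionOn (slab (EuclideanSpace ℝ (Fin 3)) (Iio 0) isOpen_Iio) 0 0 u p)
    (hH : HasWeakSpatialGradientOn (slab (EuclideanSpace ℝ (Fin 3)) (Iio 0) isOpen_Iio) u H)
    (hgauge : ∀ a : ℝ, 0 < a →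
      ENNReal.ofReal (a ^ (2 * (1 / 2 : ℝ))) * cknA a (0 : ℝ × EuclideanSpace ℝ (Fin 3)) u +
          ENNReal.ofReal (a ^ (1 / 2 : ℝ)) * cknE a (0 : ℝ × EuclideanSpace ℝ (Fin 3)) H +
        ENNReal.ofReal (a ^ (2 * (1 / 2 : ℝ))) * cknD a (0 : ℝ × EuclideanSpace ℝ (Fin 3)) p ≤ (c : ℝ≥0∞))
    (hT₁ : T₁ ≤ 0) (hP₀ : 0 < P₀) (hΛ0 : 0 < Λ) (hΛ1 : Λ ≠ 1)
    (h : ∀ τ : ℝ, τ < T₁ → ∀ y, u τ y = Λ • u (τ - P₀) (Λ⁻¹ • y)) :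
    uncurry u =ᵐ[volume.restrict (Iio (0 : ℝ) ×ˢ (univ : Set (EuclideanSpace ℝ (Fin 3))))] 0 := by
  rcases lt_or_gt_of_ne hΛ1 with hlt | hgt
  · exact ae_eq_zero_of_gauge_of_expanding (ρ := 1 / 2) (by norm_num) hsw hH hgauge hT₁ hP₀ hΛ0 hlt h
  · have hA : ∀ a : ℝ, 0 < a → ENNReal.ofReal (a ^ (2 * (1 / 2 : ℝ))) *
        cknA a (0 : ℝ × EuclideanSpace ℝ (Fin 3)) u ≤ (c : ℝ≥0∞) :=
      fun a ha => le_trans (le_trans le_self_add le_self_add) (hgauge a ha)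
    refine ae_eq_zero_of_gauge_of_contracting_of_energyBound (ρ := 1 / 2) (by norm_num) hsw hH hgauge hP₀ hgt h
      (α := T₁ - 2) (β := T₁ - 1) (E₀ := c) (by linarith) (by linarith) fun τ hτ => ?_
    have hτ0 : τ < 0 := by linarith [hτ.2]
    have := lintegral_enorm_sq_le_of_gauge_half hA hτ0
    rwa [← ENNReal.ofReal_coe_nnreal] at this

end DiscreteBreather

end Summit.NavierStokesRegularity.NavierStokesRegularity.Theorems.PowerGaugeEulerLiouville

end
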